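import Mathlib
import Summits.Ventures.PercRepro2.Defs
import Summits.Ventures.PercRepro2.Graph
import Summits.Ventures.PercRepro2.OneColourSwitch
import Summits.Ventures.PercRepro2.RegionHubSign
import Summits.Ventures.PercRepro2.SideSwitch
import Summits.Ventures.PercRepro2.SideSwitchFibre
import Summits.Ventures.PercRepro2.SideSwitchClosed
import Summits.Ventures.PercRepro2.SideSwitchComps
import Summits.Ventures.PercRepro2.M9NoPocketDefs
import Summits.Ventures.PercRepro2.M9NoPocketWorld
import Summits.Ventures.PercRepro2.M9NoPocketFibre
import Summits.Ventures.PercRepro2.M9NoPocketCompl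
import Summits.Ventures.PercRepro2.M9RegionSplit
import Summits.Ventures.PercRepro2.M9PocketCubeDefs
import Summits.Ventures.PercRepro2.M9PocketCubeFibre
import Summits.Ventures.PercRepro2.M9PocketCubeCompl
import Summits.Ventures.PercRepro2.M9PocketCubeHub
import Summits.Ventures.PercRepro2.M9PocketCubeWorldMono
import Summits.Ventures.PercRepro2.M9DeadEnd
import Summits.Ventures.PercRepro2.M9DeadEndMono
import Summits.Ventures.PercRepro2.M9DeadEndHarris
import Summits.Ventures.PercRepro2.M9LinkedHubCube
import Summits.Ventures.PercRepro2.M9LinkedGroup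
import Summits.Ventures.PercRepro2.M9LinkedGroupClosed
import Summits.Ventures.PercRepro2.M9LinkedGroupLegal
import Summits.Ventures.PercRepro2.M9LinkedGroupAnti
import Summits.Ventures.PercRepro2.M9LinkedGroupTilt1
import Summits.Ventures.PercRepro2.M9LinkedGroupTilt2
import Summits.Ventures.PercRepro2.TermSwitchM9
import Summits.Ventures.PercRepro2.M9SingleDPocket
import Summits.Ventures.PercRepro2.M9DAvoidSplit
import Summits.Ventures.PercRepro2.M9PocketCubeFibre
import Summits.Ventures.PercRepro2.M9HarrisCube
import Summits.Ventures.PercRepro2.M9PocketCubeMono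
import Summits.Ventures.PercRepro2.M9GeneralDSplit
import Summits.Ventures.PercRepro2.M9GeneralDHD
import Summits.Ventures.PercRepro2.M9LinkedHD

/-!
# The group tilt for an arbitrary antitone region, and g23's A-region `regionA ≤ 0` (blind cell
PercRepro2, p3 g29, 2026-08-28)

`groupRegionP_sum_nonpos` / `cube_sum_nonpos_of_anti`: the `Y`-pocket-group tilt of
`M9LinkedGroupTilt2` for any predicate `P` on colourings that implies `Sep ∧ DOne ∧ d ∈ K₂ ∖ M₂`
and is antitone on the group intervals of `Sep`, `K`-side points.  Applied to g23's A-region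
`regA = d ∉ M₂ ∧ ¬hubY ∧ (hubW ∨ deadW)` with `r ≁_W s` in `G − d` (antitone: `hubW` and the `W`-dead
end `deadW` by `M9PocketCubeHub` / `M9LinkedGroupAnti`, `¬hubY` constant on the interval,
`r ~_W s` in `G − d` monotone by `M9PocketCubeWorldMono`) it gives **`regionA ≤ 0`**
(`regionA_nonpos`): with `dSignSum_eq_avoid_sub`, `dSignSumAvoid_eq_two_regionA` and
`eWSum_nonneg_of_edges` this is a second, group-theoretic proof of Conjecture G
(`dSignSum_nonpos_of_edges`, p3 g24 via the trichotomy `M9ConjG`), not re-declared here; the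
general tilt `cube_sum_nonpos_of_anti` is the reusable part.  Own work; std axioms.
-/

namespace Summit.Ventures.PercRepro2

namespace NoPocket

open Finset Classical RegionHub OneColourSwitch SideSwitch TermSwitch

variable {V : Type*} {E : Type*}

section Gen

variable [Fintype V] [DecidableEq V] [Fintype E] [DecidableEq E]

variable (ends : E → Sym2 V)

/-- The region of the interval of `x` cut out by a predicate on colourings. -/
noncomputable def groupRegionP (d r s : V) (ρ : Config E) (P : Config E → Prop)
    (x : Finset (Finset V) × Finset E) : Finset (Finset (Finset V) × Finset E) :=
  (groupInterval ends d r s ρ x).filter (fun y => P (assignX ends y ρ))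

variable {ends}

/-- Membership in the region. -/
lemma mem_groupRegionP {d r s : V} {ρ : Config E} {P : Config E → Prop}
    {x y : Finset (Finset V) × Finset E} :
    y ∈ groupRegionP ends d r s ρ P x ↔ y ∈ groupInterval ends d r s ρ x ∧ P (assignX ends y ρ) := by
  simp [groupRegionP]

/-- **The tilt on a group interval for an antitone region**: `Σ_{regionP} σ̃_pq ≤ 0`. -/
theorem groupRegionP_sum_nonpos {p q r s d : V} (hr : d ≠ r) (hs : d ≠ s) {ρ : Config E}
    (hρ : ρ ∈ RepP ends p q r s d) {P : Config E → Prop}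
    {x : Finset (Finset V) × Finset E} (hx : x ∈ cubeP ends d r s ρ)
    (hsepx : sep2 ends p q r s (assignX ends x ρ)) (hKx : d ∈ K2 ends r s (assignX ends x ρ))
    (hP : ∀ y y' : Finset (Finset V) × Finset E, y ∈ groupInterval ends d r s ρ x →
      y' ∈ groupInterval ends d r s ρ x → y ≤ y' → P (assignX ends y' ρ) → P (assignX ends y ρ)) :
    ∑ y ∈ groupRegionP ends d r s ρ P x, sigma (endsD ends d) (assignX ends y ρ) p q ≤ 0 := by
  obtain ⟨hρD, _⟩ := mem_RepP.1 hρ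
  set c := groupCorner ends d r s ρ x with hc
  set ι := groupShift ends d r s ρ x with hι
  set κ := cornerDual ends d r s ρ x with hκ
  set reg := groupRegionP ends d r s ρ P x with hreg
  have hκc : ∀ z, z ≤ c → κ z ≤ c := fun z _ => ⟨Finset.sdiff_subset, Finset.sdiff_subset⟩
  have hκκ : ∀ z, z ≤ c → κ (κ z) = z := by
    intro z hz
    simp only [hκ, cornerDual]
    ext1
    · exact Finset.sdiff_sdiff_eq_self hz.1
    · exact Finset.sdiff_sdiff_eq_self hz.2
  have hκanti : AntitoneOn κ (Set.Iic c) := fun z _ z' _ hzz' =>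
    ⟨Finset.sdiff_subset_sdiff le_rfl hzz'.1, Finset.sdiff_subset_sdiff le_rfl hzz'.2⟩
  have hιmem : ∀ z, z ≤ c → ι z ∈ groupInterval ends d r s ρ x :=
    fun z hz => groupShift_mem_groupInterval hx hz
  have hικ : ∀ z, ι (κ z) = groupDual ends d r s ρ x (ι z) := fun z => groupShift_cornerDual
  have key := HarrisCube.sum_sub_comp_mul_nonneg c (κ := κ) hκc hκκ hκanti
    (f := fun z => yInd ends p q d ρ (ι z))
    (h := fun z => if ι (κ z) ∈ reg then 1 else 0)
    (fun z _ => yInd_nonneg ρ _) (fun z _ => by split_ifs <;> norm_num) ?_ ?_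
  · have hre := HarrisCube.sum_comp_involution c (κ := κ) hκc hκκ
      (fun z => (yInd ends p q d ρ (ι z) - yInd ends p q d ρ (ι (κ z))) *
        (if ι (κ z) ∈ reg then 1 else 0))
    have hsimp : ∀ z ∈ HarrisCube.cube c,
        (yInd ends p q d ρ (ι (κ z)) - yInd ends p q d ρ (ι (κ (κ z)))) *
          (if ι (κ (κ z)) ∈ reg then 1 else 0) =
        - ((yInd ends p q d ρ (ι z) - yInd ends p q d ρ (ι (κ z))) *
          (if ι z ∈ reg then 1 else 0)) := by
      intro z hz
      rw [hκκ z (HarrisCube.mem_cube.1 hz)]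
      ring
    rw [Finset.sum_congr rfl hsimp, Finset.sum_neg_distrib] at hre
    have h2 : ∑ z ∈ HarrisCube.cube c, (yInd ends p q d ρ (ι z) - yInd ends p q d ρ (ι (κ z))) *
        (if ι z ∈ reg then 1 else 0) ≤ 0 := by linarith
    calc ∑ y ∈ reg, sigma (endsD ends d) (assignX ends y ρ) p q
        ≤ ∑ y ∈ reg, (yInd ends p q d ρ y - yInd ends p q d ρ (groupDual ends d r s ρ x y)) :=
          Finset.sum_le_sum (fun y hy =>
            sigma_endsD_le_sub_groupDual hr hs hρ hx hsepx hKx (mem_groupRegionP.1 hy).1)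
      _ = ∑ z ∈ (HarrisCube.cube c).filter (fun z => ι z ∈ reg),
            (yInd ends p q d ρ (ι z) - yInd ends p q d ρ (ι (κ z))) := by
          refine Finset.sum_nbij' (fun y => (y.1, y.2 \ (groupLo ends d r s ρ x).2)) ι ?_ ?_ ?_ ?_ ?_
          · intro y hy
            obtain ⟨h1, h2⟩ := exists_groupShift_eq (mem_groupRegionP.1 hy).1
            refine Finset.mem_filter.2 ⟨HarrisCube.mem_cube.2 h1, ?_⟩
            rw [hι, h2]
            exact hy
          · intro z hz
            exact (Finset.mem_filter.1 hz).2
          · intro y hy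
            exact (exists_groupShift_eq (mem_groupRegionP.1 hy).1).2
          · intro z hz
            have hzc := HarrisCube.mem_cube.1 (Finset.mem_filter.1 hz).1
            obtain ⟨h1, h2⟩ := exists_groupShift_eq (hιmem z hzc)
            exact groupShift_injOn h1 hzc h2
          · intro y hy
            obtain ⟨h1, h2⟩ := exists_groupShift_eq (mem_groupRegionP.1 hy).1
            rw [hικ, hι, h2]
      _ = ∑ z ∈ HarrisCube.cube c, (yInd ends p q d ρ (ι z) - yInd ends p q d ρ (ι (κ z))) *
            (if ι z ∈ reg then 1 else 0) := by
          rw [Finset.sum_filter]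
          refine Finset.sum_congr rfl fun z _ => ?_
          split_ifs <;> simp
      _ ≤ 0 := h2
  · intro z hz z' hz' hzz'
    have hz1 := mem_cubeP_of_mem_groupInterval (hιmem z hz)
    have hz1' := mem_cubeP_of_mem_groupInterval (hιmem z' hz')
    obtain ⟨hT, hF⟩ := mem_cubeP.1 hz1
    simp only [yInd]
    split_ifs with h1 h2
    · exact le_rfl
    · exfalso
      apply h2
      exact conn_endsD_assignX_mono hr hs hρ (groupShift_mono hzz') hz1 hz1'
        (not_mem_K2_of_sep2 (sep2_endsD_assignX' hr hs hρD hT hF)).1 h1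
    · norm_num
    · exact le_rfl
  · intro z hz z' hz' hzz'
    dsimp only
    split_ifs with h1 h2
    · exact le_rfl
    · exfalso
      apply h2
      refine mem_groupRegionP.2 ⟨hιmem _ (hκc z' hz'), ?_⟩
      exact hP _ _ (hιmem _ (hκc z' hz')) (hιmem _ (hκc z hz))
        (groupShift_mono (hκanti hz hz' hzz')) (mem_groupRegionP.1 h1).2
    · norm_num
    · exact le_rfl

/-- **The cube sum of an antitone `Sep`, `K`-side region is non-positive.** -/
theorem cube_sum_nonpos_of_anti {p q r s d : V} (hr : d ≠ r) (hs : d ≠ s) {ρ : Config E}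
    (hρ : ρ ∈ RepP ends p q r s d) {P : Config E → Prop}
    (hPK : ∀ ω, P ω → sep2 ends p q r s ω ∧ DOne ends r s d ω ∧ d ∈ K2 ends r s ω ∧
      d ∉ M2 ends r s ω)
    (hP : ∀ x : Finset (Finset V) × Finset E, x ∈ cubeP ends d r s ρ →
      sep2 ends p q r s (assignX ends x ρ) → d ∈ K2 ends r s (assignX ends x ρ) →
      ∀ y y' : Finset (Finset V) × Finset E, y ∈ groupInterval ends d r s ρ x →
        y' ∈ groupInterval ends d r s ρ x → y ≤ y' → P (assignX ends y' ρ) →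
          P (assignX ends y ρ)) :
    ∑ x ∈ (cubeP ends d r s ρ).filter (fun x => P (assignX ends x ρ)),
      sigma (endsD ends d) (assignX ends x ρ) p q ≤ 0 := by
  obtain ⟨hρD, _⟩ := mem_RepP.1 hρ
  set S := (cubeP ends d r s ρ).filter (fun x => P (assignX ends x ρ)) with hS
  have hself : ∀ x ∈ S, x ∈ groupInterval ends d r s ρ x := by
    intro x hx
    obtain ⟨hxc, hPx⟩ := Finset.mem_filter.1 hx
    obtain ⟨_, hD, hK, hM⟩ := hPK _ hPx
    exact self_mem_groupInterval_of_K hr hs hρ hxc hK hM hD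
  have hmaps : ∀ x ∈ S, groupRegionP ends d r s ρ P x ∈
      S.image (groupRegionP ends d r s ρ P) := fun x hx => Finset.mem_image_of_mem _ hx
  rw [← Finset.sum_fiberwise_of_maps_to hmaps]
  refine Finset.sum_nonpos fun I hI => ?_
  obtain ⟨x₀, hx₀, rfl⟩ := Finset.mem_image.1 hI
  obtain ⟨hx₀c, hPx₀⟩ := Finset.mem_filter.1 hx₀
  obtain ⟨hsep₀, _, hK₀, _⟩ := hPK _ hPx₀
  have hfib : S.filter (fun x => groupRegionP ends d r s ρ P x = groupRegionP ends d r s ρ P x₀) =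
      groupRegionP ends d r s ρ P x₀ := by
    ext y
    constructor
    · intro hy
      obtain ⟨hyS, hyeq⟩ := Finset.mem_filter.1 hy
      rw [← hyeq]
      exact mem_groupRegionP.2 ⟨hself y hyS, (Finset.mem_filter.1 hyS).2⟩
    · intro hy
      obtain ⟨hyI, hyP⟩ := mem_groupRegionP.1 hy
      refine Finset.mem_filter.2 ⟨Finset.mem_filter.2 ⟨mem_cubeP_of_mem_groupInterval hyI, hyP⟩, ?_⟩
      simp only [groupRegionP, groupInterval_eq_of_mem hρD hx₀c hyI]
  rw [hfib]
  exact groupRegionP_sum_nonpos hr hs hρ hx₀c hsep₀ hK₀ (hP x₀ hx₀c hsep₀ hK₀)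

end Gen

section ConjG

variable [Fintype V] [DecidableEq V] [Fintype E] [DecidableEq E] {ends : E → Sym2 V}
  {p q r s d : V}

/-- g23's A-region with `r ≁_W s` in `G − d`, as a predicate on colourings. -/
def regAW (ends : E → Sym2 V) (p q r s d : V) (ω : Config E) : Prop :=
  sep2 ends p q r s ω ∧ DOne ends r s d ω ∧ regA ends p q r s d ω ∧
    ¬ Conn (endsD ends d) (OneColourSwitch.compl ω) r s

omit [Fintype V] [DecidableEq V] [Fintype E] [DecidableEq E] in
/-- With an edge `d–r`, the A-region is `K`-side. -/
lemma regAW_kside {er : E} (her : ends er = s(d, r)) {ω : Config E} (h : regAW ends p q r s d ω) :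
    sep2 ends p q r s ω ∧ DOne ends r s d ω ∧ d ∈ K2 ends r s ω ∧ d ∉ M2 ends r s ω := by
  obtain ⟨hsep, hD, ⟨hM, _, _⟩, _⟩ := h
  refine ⟨hsep, hD, ?_, hM⟩
  rcases mem_K2_or_mem_M2 ω her with h1 | h1
  · exact h1
  · exact absurd h1 hM

/-- **The A-region is antitone on the group intervals** of `Sep`, `K`-side points. -/
lemma regAW_anti (hr : d ≠ r) (hs : d ≠ s) (hpd : p ≠ d) (hqd : q ≠ d) {ρ : Config E}
    (hρ : ρ ∈ RepP ends p q r s d) {x : Finset (Finset V) × Finset E}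
    (hx : x ∈ cubeP ends d r s ρ) (hsepx : sep2 ends p q r s (assignX ends x ρ))
    (hKx : d ∈ K2 ends r s (assignX ends x ρ)) {y y' : Finset (Finset V) × Finset E}
    (hy : y ∈ groupInterval ends d r s ρ x) (hy' : y' ∈ groupInterval ends d r s ρ x)
    (hyy' : y ≤ y') (h : regAW ends p q r s d (assignX ends y' ρ)) :
    regAW ends p q r s d (assignX ends y ρ) := by
  obtain ⟨_, _, ⟨_, _, hWD⟩, hrs⟩ := h
  obtain ⟨hsep, hD, _, hM⟩ := kside_of_mem_groupInterval hr hs hpd hqd hρ hx hsepx hKx hy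
  obtain ⟨hρD, _⟩ := mem_RepP.1 hρ
  have hcy := mem_cubeP_of_mem_groupInterval hy
  have hcy' := mem_cubeP_of_mem_groupInterval hy'
  refine ⟨hsep, hD, ⟨hM, not_hubY_of_mem_groupInterval hr hs hρ hx hsepx hKx hy, ?_⟩, ?_⟩
  · rcases hWD with h1 | ⟨v, hvr, hvs, hvd, hvK, hvc⟩
    · exact Or.inl (hubW_assignX_anti hr hs hpd hqd hρ hyy' hcy hcy' h1)
    · exact Or.inr ⟨v, hvr, hvs, hvd, mem_K2_of_K2_of_le hr hs hρ hx hKx hy hy' hyy' hvd hvK,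
        conn_compl_d_anti_of_mem_groupInterval hr hs hρ hy hy' hyy' hvd hvc⟩
  · intro hc
    apply hrs
    exact conn_endsD_compl_assignX_mono_of_mem_M2 hr hs hρD hyy' hcy hcy'
      (mem_M2_iff.2 (Or.inl (conn_refl _ _ _))) hc

/-- **g23's A-region sum is non-positive** on every graph with an edge `d–r`. -/
theorem regionA_nonpos (hr : d ≠ r) (hs : d ≠ s) (hpd : p ≠ d) (hqd : q ≠ d) {er : E}
    (her : ends er = s(d, r)) : regionA ends p q r s d ≤ 0 := by
  have h1 : regionA ends p q r s d = ∑ ω ∈ DOneSet ends p q r s d,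
      (if regAW ends p q r s d ω then sigma (endsD ends d) ω p q else 0) := by
    unfold DOneSet
    rw [Finset.sum_filter]
    unfold regionA
    refine Finset.sum_congr rfl fun ω _ => ?_
    simp only [regAW]
    by_cases hC : sep2 ends p q r s ω ∧ DOne ends r s d ω ∧ regA ends p q r s d ω ∧
        ¬ Conn (endsD ends d) (OneColourSwitch.compl ω) r s
    · rw [if_pos hC, if_pos ⟨hC.1, hC.2.1⟩, if_pos hC]
    · rw [if_neg hC]
      split_ifs <;> rfl
  rw [h1, sum_dOne_eq_sum_repP_legalP hr hs]
  refine Finset.sum_nonpos fun ρ hρ => ?_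
  have h2 : ∑ x ∈ LegalP ends p q r s d ρ,
      (if regAW ends p q r s d (assignX ends x ρ) then sigma (endsD ends d) (assignX ends x ρ) p q
        else 0) = ∑ x ∈ (cubeP ends d r s ρ).filter (fun x => regAW ends p q r s d (assignX ends x ρ)),
        sigma (endsD ends d) (assignX ends x ρ) p q := by
    rw [← Finset.sum_filter]
    refine Finset.sum_congr ?_ fun _ _ => rfl
    ext x
    simp only [Finset.mem_filter, mem_LegalP, mem_DOneSet]
    constructor
    · rintro ⟨⟨hc, _⟩, h⟩
      exact ⟨hc, h⟩
    · rintro ⟨hc, h⟩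
      exact ⟨⟨hc, h.1, h.2.1⟩, h⟩
  rw [h2]
  exact cube_sum_nonpos_of_anti hr hs hρ (fun _ h => regAW_kside her h)
    (fun x hx hsepx hKx y y' hy hy' hyy' h => regAW_anti hr hs hpd hqd hρ hx hsepx hKx hy hy' hyy' h)

end ConjG

end NoPocket

end Summit.Ventures.PercRepro2
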